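import Summits.QuantumFields.YangMills.Theorems.BalabanUVNodesRateReadingOfRecord13
import Summits.QuantumFields.YangMills.Theorems.BalabanUVNodesN22AtW1Reading13Co
import Summits.QuantumFields.YangMills.Theorems.BalabanUVNodesRateCarriersOfRecord13CoOn
import Literature.MathematicalPhysics.QuantumFieldTheory.Balaban1983to89.Node00.RateRecord11NE3Data

/-!
# CORE EDITION of 6″ `BalabanUVNodesRateReadingOfRecord13` (p495075) — THE RATE READING OF RECORD `readingOfRecord₁₃Co w1 ℓ₃ ne2 ne1` (edition 1) + rfl faces + stub faces at both homes — KEYED ON THE bg-FREE PROVISO CORE `Stage13Params.Provisos₁₃Core` (the LAST re-key of this module).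
#
# WHY THIS FILE EXISTS (plan g67 ★ CORE-YES, pub-ymgap INBOX l.17420; WORD-139 (1) l.16747; dag-lead WORDS-139 (3) l.16541; RR-2 g11 CORE l.17476; this seat's
# DESIGN-INPUT-CORE l.17415).  The Stage-13 record's proviso structure is being re-pinned row by row toward print (v1.1 `Provisos₁₃` → v1.2 `Provisos₁₃Sep`
# (separated sequences + `PartCompat₁₃`, director-ym №136–№139) → v1.3 `Provisos₁₃SepMixed` (+ `Sect2.DataSmall7`, №142) → …); each edition re-mints the four cruxes and
# would re-key every storey typed `∀ θ (h : θ.Provisos₁₃<ed> F N), …`.  But the rate-side storeys are bg-BLIND and proviso-FIELD-blind: `h` enters only as a binder TYPE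
# and inside `datumOfRecord₁₃<ed> F N θ h`; def-T's `Node00/Record13` v1.2 (p501191) carries the edition-free proviso CORE `Stage13Params.Provisos₁₃Core` (the nine non-bg rows)
# with the maps `Provisos₁₃<ed>.toCore`, and — after director-ym №151∕№152 re-based the record at print's background U_k(V) (`UbgOfRecord₁₃Co`) — def-T's FILE 21
# `Node00/Record13Co` (p515035) carries the Core-KEYED tower ∕ datum ∕ record `towerOfRecord₁₃Co ∕ datumOfRecord₁₃Co ∕ IsRecordOfRecord₁₃CCo` with the `rfl` bridges
# `datumOfRecord₁₃<ed> F N θ h = datumOfRecord₁₃Co F N θ h.toCore` for every LATER edition (v1.4 `SepCo`, KEY-RULE-21 R4; v1.2's U_old `datumOfRecord₁₃Core` is superseded,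
# def-T HOLD-21C).  So plan ruled (CORE-YES):
# CONSUMER storeys key ONCE on `(hc : θ.Provisos₁₃Core F N)` ∕ `datumOfRecord₁₃Co` ∕ RR-2's bg-free datum key `Node00/Record13DatumKeyCo` (p515777; its `IsDatumOfRecord…` ∕ `IsRateKey…` classes,
# the record classes `IsRecordOfRecord…`, one-way bridges `.toCore` from every edition's keys), while the ITEM texts and the registered STUB texts stay
# edition-keyed and ONLY the K3 composer touches the item's proviso token — at an item tuple `(θ, h : θ.Provisos₁₃<ed> F 2)` it applies these storeys at `hc := h.toCore`,
# datum by `rfl`.  This file is the (T-RATE) pen's CORE twin of its own ‴ module under the token map `Provisos₁₃ ↦ Provisos₁₃Core` · `datumOfRecord₁₃ ↦ datumOfRecord₁₃Core` ·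
# `(Is|is)DatumOfRecord₁₃C… ↦ …₁₃CCore…` · `(Is|is)RecordOfRecord₁₃C… ↦ …₁₃CCore…` · `IsRateKey₁₃ ↦ IsRateKey₁₃Core` and, for THIS seat's names, `Core` inserted after `₁₃`
# in the stage-KEYED stems only (`RateReading₁₃`, `rateCarriersOfRecord₁₃`, `RRec₁₃(On)`, `rRec₁₃…`, `readingOfRecord₁₃`, `…datumKey₁₃…`, `n22_tupleReadingOfRecord(On)…`).
# EVERYTHING θ-LEVEL IS UNCHANGED AND NOT RE-DECLARED: `Stage13Params`, `u3OfRecord₁₃ θ u k` and its faces, the θ-form closers `n22At_u3OfRecord₁₃_…` of the ‴ modules carry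
# no proviso and are IMPORTED BY NAME (this module imports its ‴ original) — here: none of the original's decls is θ-only.  Statements = the ‴ statements under the map, proofs = the ‴ proofs verbatim.  The ⁗
# `…13Sep…` twin of this module (rev-18∕19 homes) stays in the tree as the ⁗ asides' context.  NOMINAL STRENGTH: Core-keyed storeys quantify over more tuples (no bg row) —
# harmless: every hypothesis here is θ-generic under `θ.Admissible` and the slot data, none reads `bg`.
#
# ITEM IDS: crux names ∕ item ids quoted in the ‴ header below (K0‴–K3‴ = stmt-QuantumFields-19909…19912) are the rev-16∕17 ones, ASIDES now; this file is filed
# `--supports stmt-QuantumFields-20292` (the K3 item of record at filing time, per dag-lead's KEY MAP) as a HELPER — count-neutral, no stub closed, N22 NOT discharged, no inhabitant of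
# any key claimed (K0 OPEN at every edition).
#
# ‴ HEADER OF RECORD FOLLOWS (token-mapped; its decl lists are this file's, the θ-only names above excepted):
#
# THE RATE READING OF RECORD AT STAGE 13, EDITION 1 — `YMDAG.UVSplit.readingOfRecord₁₃Co w1 ℓ₃ ne2 ne1 : RateReading₁₃Co N`: the (T-RATE) home's Stage-13 reading with the
# TWO components the definers have PINNED BY NAME plugged in — node U3's objects := node00-def-W1's W1 reading data `(w1 F θ).u3Objects θ.γ` read per Stage-13 tuple
# (`Node00/RateRecordW1Reading` §3, p465810; `w1 : (F : T4Family) → (θ : Stage13Params F N) → W1.ReadingData F (M_N ℂ) θ.τ9.M`) and N16's NE3 layer := node00-def-RR-1's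
# CONSTANT READING OF RECORD `ne3ConstReadingOfRecord₁₁ F N (ℓ₃ F)` (`Node00/RateRecord11NE3Data`, p467746) — the other two (N15's `ne2`, NODE O's dressed tower `ne1`)
# RESIDUAL parameters typed over `Stage13Params`; and what the K4 stubs at `RRec₁₃Co (readingOfRecord₁₃Co …)` ∕ `RRec₁₃CoOn (readingOfRecord₁₃Co …) Rg` SAY, by name

Track A of `YM-PLAN.md` (cell `pub-ymgap`, HUMAN RULING D-0062), R134 seat `pub-ymgap-dag-n22-e` ((T-RATE) pen), gen 5, module 6″ = the Stage-13 edition of the lineage's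
module 6 `…RateReadingOfRecord12.lean` (p469629; director-ym LINE №125 «RECORD 13» ∕ №133, route rev 16 ∕ 17, K3‴ `SpineGivenEndpointR13` = stmt-QuantumFields-19912;
dag-lead WORDS-133 ∕ 134 ∕ 135).  WHY.  «A skeleton quoting `S_N1x (RRec₁₃Co 𝔯)` NAMES its `𝔯`» (layer B's binding framing): this module NAMES the Stage-13 reading of record as
far as the tree's definers have pinned it — DIRECTLY over the Stage-13-typed residual maps (no Stage-12 lift `RateAssignment₁₃.ofStage12 (W1.assignment₁₂ 𝔇)`, which would
read the W1 data off `θ.toStage12Params` only; no new W1 container is minted — W1's STAGE-FREE `ReadingData` is consumed by name), so that the `hpin`-generic N22 ∕ N16 faces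
at ₁₃ (`…N22AtW1Reading13`, dag-n16-e's `…N16AtTupleReading13` ∕ pre-staged `…N16AtRRec13`) instantiate here with `hpin := rfl`.  Definition lane (ONE `def`); every theorem
is kernel bookkeeping; 0 `sorry`; COUNT-NEUTRAL; `--supports` K3‴ as a helper.  Restate-immune (no Theses import); nothing landed is edited.

WHAT THIS MODULE PROVES ([bookkeeping]).
* §1 `readingOfRecord₁₃Co w1 ℓ₃ ne2 ne1` · component faces `readingOfRecord₁₃Co_u3 ∕ _ne3 ∕ _ne2 ∕ _ne1` (`rfl`) · `readingOfRecord₁₃Co_populated_iff` (the reading's objects are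
  POPULATED iff N15's residual layer is — W1's U3 layer and RR-1's constant layer are populated unconditionally).
* §2 WHAT THE STUBS SAY AT `RRec₁₃Co (readingOfRecord₁₃Co …)`: `s_N16_readingOfRecord₁₃Co_iff` (N16 = `N16At (ne3OfRecord₁₁ F (ne3ConstLayerOfRecord₁₁ F N (ℓ₃ F)))` at every family
  carrying a Stage-13 datum of record — ONE sentence per family) · `n16At_of_s_N16_readingOfRecord₁₃Co` · `s_N22_readingOfRecord₁₃Co_iff` ∕ `_iff_ne9` (N22 = the
  history-Lipschitz inequality for W1's `Re E(S k)(X; ·; embA U)` per key and run length — module 9″c with `hpin := rfl`) · `s_N22_readingOfRecord₁₃Co_of_oscAnalytic` (ROAD 3) ·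
  `s_N22_readingOfRecord₁₃Co_of_ne9_fading` · `s_N18_readingOfRecord₁₃Co_iff` · `s_N15 ∕ s_N14_readingOfRecord₁₃Co_iff` · `s_N17 ∕ s_D4_readingOfRecord₁₃Co_iff` (on the datum).
* §3 THE GUARDED θ-FORMS at the regime home `RRec₁₃CoOn (readingOfRecord₁₃Co …) Rg` (what a rev-16 composer with the guard inside reads): `s_N22_readingOfRecord₁₃CoOn_iff` ·
  `s_N16_readingOfRecord₁₃CoOn_iff` · `s_N18_readingOfRecord₁₃CoOn_iff`.
* §4 HONESTY: `s_N22_readingOfRecord₁₃Co_of_EA_zero` (vanishing W1 towers close N22's stub at the reading of record: the towers are DATA, not yet the construction's (2.14) terms).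

HONEST FRAMING.  Two pins CONSUMED BY NAME (W1's stage-free reading-data container — whose towers are residual data —, RR-1's constant NE3 reading — a pin CONVENTION with
parametric letters); two components residual; every node estimate (NE1′, NE2, NE3, NE4, NE5, NE9) is a DISPLAYED hypothesis with no producer at this reading today; nothing of
Bałaban's is asserted or instantiated; NE1′–NE9 are NOT PRINTED for d = 4 and NOT PROVED; no inhabitant of `IsDatumOfRecord₁₃CCo` claimed (K0‴ `Record13Inhabited`,
stmt-QuantumFields-19909, OPEN); no node discharged; counts UNMOVED (typed 28∕28 · discharged 5∕27, A 5∕28); one finite four-torus programme at fixed `ε` — NOT ℝ⁴, NOT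
infinite volume, NOT OS, NOT a mass gap, NOT Clay.  No decl below carries a cite tag.
-/

noncomputable section

namespace YMDAG.UVSplit

open Set Metric
open scoped BigOperators
open Literature.MathematicalPhysics.QuantumFieldTheory.Balaban1983to89
open Literature.MathematicalPhysics.QuantumFieldTheory.Balaban1983to89.T4Continuum
open Literature.MathematicalPhysics.QuantumFieldTheory.Balaban1983to89.T4OutputRate
open Literature.MathematicalPhysics.QuantumFieldTheory.Balaban1983to89.Node00 (Stage13Params datumOfRecord₁₃Co IsDatumOfRecord₁₃CCo NE3Letters₁₁ NE2Objects₁₁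
  ne3ConstLayerOfRecord₁₁ ne3ConstReadingOfRecord₁₁ MatA)
open Literature.MathematicalPhysics.QuantumFieldTheory.Balaban1983to89.Node00.Sect2 (domSys)
open Literature.MathematicalPhysics.QuantumFieldTheory.Balaban1983to89.Node00.W1 (ReadingData functionalC)

variable {N : ℕ} [NeZero N]

/-! ## §1 The Stage-13 reading of record, edition 1, and its component faces -/

/-- **THE RATE READING OF RECORD AT STAGE 13, EDITION 1**: node U3's objects := W1's reading data at window radius `θ.γ`; N16's layer := RR-1's constant reading of record with
letters `ℓ₃ F`; N15's layer `ne2` and NODE O's dressed tower `ne1` residual — all read PER STAGE-13 TUPLE (the provisos are not read). -/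
def readingOfRecord₁₃Co (w1 : (F : T4Family) → (θ : Stage13Params F N) → ReadingData F (MatA N) θ.τ9.M) (ℓ₃ : T4Family → NE3Letters₁₁)
    (ne2 : (F : T4Family) → Stage13Params F N → (ℕ → ℝ) → List (ULoop F) → ℕ → NE2Objects₁₁)
    (ne1 : (F : T4Family) → Stage13Params F N → (ℕ → ℝ) → List (ULoop F) → NE1pCarriers) : RateReading₁₃Co N :=
  ⟨fun F θ _ g₀ os => ⟨(w1 F θ).u3Objects θ.γ, ne3ConstReadingOfRecord₁₁ F N (ℓ₃ F), ne2 F θ g₀ os⟩, fun F θ _ g₀ os => ne1 F θ g₀ os⟩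

section Faces

variable (w1 : (F : T4Family) → (θ : Stage13Params F N) → ReadingData F (MatA N) θ.τ9.M) (ℓ₃ : T4Family → NE3Letters₁₁)
  (ne2 : (F : T4Family) → Stage13Params F N → (ℕ → ℝ) → List (ULoop F) → ℕ → NE2Objects₁₁)
  (ne1 : (F : T4Family) → Stage13Params F N → (ℕ → ℝ) → List (ULoop F) → NE1pCarriers)

/-- Face: node U3's objects of the reading of record ARE W1's at window radius `θ.γ` (`rfl`) — module 9″c's `hpin`. -/
theorem readingOfRecord₁₃Co_u3 (F : T4Family) (θ : Stage13Params F N) (hP : θ.Provisos₁₃Core F N) (g₀ : ℕ → ℝ) (os : List (ULoop F)) :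
    ((readingOfRecord₁₃Co w1 ℓ₃ ne2 ne1).lit F θ hP g₀ os).u3 = (w1 F θ).u3Objects θ.γ := rfl

/-- Face: N16's layer of the reading of record IS RR-1's constant layer of record at EVERY run length (`rfl`) — dag-n16-e's `hpin` ∕ `hconst`. -/
theorem readingOfRecord₁₃Co_ne3 (F : T4Family) (θ : Stage13Params F N) (hP : θ.Provisos₁₃Core F N) (g₀ : ℕ → ℝ) (os : List (ULoop F)) (k : ℕ) :
    ((readingOfRecord₁₃Co w1 ℓ₃ ne2 ne1).lit F θ hP g₀ os).ne3 k = ne3ConstLayerOfRecord₁₁ F N (ℓ₃ F) := rfl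

/-- Face: N16's component IS RR-1's object of record `ne3OfRecord₁₁ F (ne3ConstLayerOfRecord₁₁ F N (ℓ₃ F))` (`rfl`; the `hpin` of `…N16AtTupleReading13` at the level-selected
tuple reading of this home). -/
theorem readingOfRecord₁₃Co_ne3OfRecord (F : T4Family) (θ : Stage13Params F N) (hP : θ.Provisos₁₃Core F N) (g₀ : ℕ → ℝ) (os : List (ULoop F)) (k : ℕ) :
    (rateCarriersOfRecord₁₃Co (readingOfRecord₁₃Co w1 ℓ₃ ne2 ne1) F θ hP g₀ os k).ne3 = ne3OfRecord₁₁ F (ne3ConstLayerOfRecord₁₁ F N (ℓ₃ F)) := rfl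

/-- Face: N15's layer is the residual one (`rfl`). -/
theorem readingOfRecord₁₃Co_ne2 (F : T4Family) (θ : Stage13Params F N) (hP : θ.Provisos₁₃Core F N) (g₀ : ℕ → ℝ) (os : List (ULoop F)) (k : ℕ) :
    ((readingOfRecord₁₃Co w1 ℓ₃ ne2 ne1).lit F θ hP g₀ os).ne2 k = ne2 F θ g₀ os k := rfl

/-- Face: N14's dressed tower is the residual one (`rfl`). -/
theorem readingOfRecord₁₃Co_ne1 (F : T4Family) (θ : Stage13Params F N) (hP : θ.Provisos₁₃Core F N) (g₀ : ℕ → ℝ) (os : List (ULoop F)) :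
    (readingOfRecord₁₃Co w1 ℓ₃ ne2 ne1).ne1 F θ hP g₀ os = ne1 F θ g₀ os := rfl

/-- Face: the U3 component of the run-length-`k` bundle IS `u3OfRecord₁₃ θ ((w1 F θ).u3Objects θ.γ) k` (`rfl`). -/
theorem readingOfRecord₁₃Co_bundle_u3 (F : T4Family) (θ : Stage13Params F N) (hP : θ.Provisos₁₃Core F N) (g₀ : ℕ → ℝ) (os : List (ULoop F)) (k : ℕ) :
    (rateCarriersOfRecord₁₃Co (readingOfRecord₁₃Co w1 ℓ₃ ne2 ne1) F θ hP g₀ os k).u3 = u3OfRecord₁₃ θ ((w1 F θ).u3Objects θ.γ) k := rfl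

/-- **THE READING OF RECORD IS POPULATED IFF N15's RESIDUAL LAYER IS** — W1's U3 layer (`ReadingData.u3Objects_populated`) and RR-1's constant NE3 layer
(`populated_ne3ConstLayerOfRecord₁₁`) are populated UNCONDITIONALLY. -/
theorem readingOfRecord₁₃Co_populated_iff (F : T4Family) (θ : Stage13Params F N) (hP : θ.Provisos₁₃Core F N) (g₀ : ℕ → ℝ) (os : List (ULoop F)) :
    ((readingOfRecord₁₃Co w1 ℓ₃ ne2 ne1).lit F θ hP g₀ os).Populated ↔ ∀ k, (ne2 F θ g₀ os k).Populated :=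
  ⟨fun h => h.2.2, fun h => ⟨(w1 F θ).u3Objects_populated θ.γ, fun _ => Node00.populated_ne3ConstLayerOfRecord₁₁ F N (ℓ₃ F), h⟩⟩

/-! ## §2 What the K4 stubs say at `RRec₁₃Co (readingOfRecord₁₃Co w1 ℓ₃ ne2 ne1)` -/

/-- **N16 AT THE READING OF RECORD**: `S_N16` IS «`N16At (ne3OfRecord₁₁ F (ne3ConstLayerOfRecord₁₁ F N (ℓ₃ F)))` for every family carrying a Stage-13 datum of record» — ONE
sentence per family about RR-1's NAMED unit-lattice data (layer B's `s_N16_rRec₁₃Co_iff`, the constant layer by `rfl`). -/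
theorem s_N16_readingOfRecord₁₃Co_iff :
    S_N16 (RRec₁₃Co (readingOfRecord₁₃Co w1 ℓ₃ ne2 ne1)) ↔
      ∀ (F : T4Family), (∃ D : Datum F N, IsDatumOfRecord₁₃CCo F N D) → N16At (ne3OfRecord₁₁ F (ne3ConstLayerOfRecord₁₁ F N (ℓ₃ F))) := by
  rw [s_N16_rRec₁₃Co_iff]
  exact ⟨fun H F ⟨D, h⟩ => H F D h (fun _ => 0) [] 0, fun H F D h _ _ _ => H F ⟨D, h⟩⟩

/-- … so under `S_N16` at the reading of record, `N16At` holds at RR-1's layer of every family with a datum of record (n21-d's `h16` binder, named). -/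
theorem n16At_of_s_N16_readingOfRecord₁₃Co (hS : S_N16 (RRec₁₃Co (readingOfRecord₁₃Co w1 ℓ₃ ne2 ne1))) (F : T4Family) {D : Datum F N}
    (hD : IsDatumOfRecord₁₃CCo F N D) : N16At (ne3OfRecord₁₁ F (ne3ConstLayerOfRecord₁₁ F N (ℓ₃ F))) :=
  (s_N16_readingOfRecord₁₃Co_iff w1 ℓ₃ ne2 ne1).mp hS F ⟨D, hD⟩

/-- **N22 AT THE READING OF RECORD**: `S_N22` IS «`N22At` at every Stage-13 datum key and run length of W1's objects at the canonical parameter» (module 9″c; `ne1 ∕ ne2 ∕ ne3`,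
`g₀`, `os` idle). -/
theorem s_N22_readingOfRecord₁₃Co_iff :
    S_N22 (RRec₁₃Co (readingOfRecord₁₃Co w1 ℓ₃ ne2 ne1)) ↔
      ∀ (F : T4Family) (D : Datum F N) (h : IsDatumOfRecord₁₃CCo F N D) (k : ℕ), N22At (u3OfRecord₁₃ h.params ((w1 F h.params).u3Objects h.params.γ) k) :=
  YMDAG.N22.s_N22_rRec₁₃Co_w1_iff _ w1 fun _ _ _ _ _ => rfl

/-- **… IN PRINT-LIKE FORM** (under the analytic blocks' signs at the canonical parameters): the history-Lipschitz inequality for `Re E((w1 F θ).S k)(X; ·; embA U)` on `]0, θ.γ]`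
per key and run length (module 9″c's `s_N22_rRec₁₃Co_w1_iff_ne9`). -/
theorem s_N22_readingOfRecord₁₃Co_iff_ne9
    (hs : ∀ (F : T4Family) (D : Datum F N) (h : IsDatumOfRecord₁₃CCo F N D), ((w1 F h.params).li.analytic h.params.γ).Signs) :
    S_N22 (RRec₁₃Co (readingOfRecord₁₃Co w1 ℓ₃ ne2 ne1)) ↔
      ∀ (F : T4Family) (D : Datum F N) (h : IsDatumOfRecord₁₃CCo F N D) (k : ℕ),
        ∀ g ∈ Window h.params.γ, ∀ g' ∈ Window h.params.γ,
          ∀ (U : ((w1 F h.params).pairing k).BgA) (X : Node00.W1.Dom (F.P k) h.params.τ9.M),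
            |(functionalC ((w1 F h.params).S k) g (((w1 F h.params).pairing k).embA U) X).re -
                (functionalC ((w1 F h.params).S k) g' (((w1 F h.params).pairing k).embA U) X).re| ≤
              Real.exp (-(((w1 F h.params).li.analytic h.params.γ).κ * (domSys (F.P k) h.params.τ9.M X.1).dj X.2)) *
                ∑ i ∈ Finset.range X.1, ((w1 F h.params).li.analytic h.params.γ).moduli X.1 i * |g i - g' i| :=
  YMDAG.N22.s_N22_rRec₁₃Co_w1_iff_ne9 _ w1 (fun _ _ _ _ _ => rfl) hs

/-- **ROAD 3 AT THE READING OF RECORD** (module 9″c's `s_N22_rRec₁₃Co_w1_of_oscAnalytic` with `hpin := rfl`). -/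
theorem s_N22_readingOfRecord₁₃Co_of_oscAnalytic
    (hnum : ∀ (F : T4Family) (θ : Stage13Params F N), θ.Provisos₁₃Core F N → θ.Admissible F N →
      0 < (w1 F θ).li.C₀ ∧ 0 < (w1 F θ).li.θ₅ ∧ 0 < (w1 F θ).li.A ∧ (w1 F θ).li.θ₅ ≤ (w1 F θ).li.μ ∧
        (w1 F θ).li.C₀ ≤ 2 * (w1 F θ).li.A ∧ 0 < (w1 F θ).li.r ∧ 0 < (w1 F θ).li.s ∧ (w1 F θ).li.s < 1)
    (hO : ∀ (F : T4Family) (θ : Stage13Params F N), θ.Provisos₁₃Core F N → θ.Admissible F N → ∀ (k : ℕ),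
      ∀ g ∈ Window θ.γ, ∀ g' ∈ Window θ.γ, ∀ (U : (((w1 F θ).u3Objects θ.γ).levelCarriers k).BgA)
        (X : (((w1 F θ).u3Objects θ.γ).levelCarriers k).Dom) (a : ℕ), a ≤ (((w1 F θ).u3Objects θ.γ).levelCarriers k).scale X →
        (∀ n, a ≤ n → g n = g' n) →
          |((w1 F θ).u3Objects θ.γ).EA k g U X - ((w1 F θ).u3Objects θ.γ).EA k g' U X| ≤
            (w1 F θ).li.C₀ * ((w1 F θ).u3Objects θ.γ).θ₅ ^ ((((w1 F θ).u3Objects θ.γ).levelCarriers k).scale X - a) *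
              Real.exp (-(((w1 F θ).u3Objects θ.γ).κ * (((w1 F θ).u3Objects θ.γ).levelCarriers k).d X)))
    (hA : ∀ (F : T4Family) (θ : Stage13Params F N), θ.Provisos₁₃Core F N → θ.Admissible F N → ∀ (k : ℕ),
      ∀ g ∈ Window θ.γ, ∀ (U : (((w1 F θ).u3Objects θ.γ).levelCarriers k).BgA) (X : (((w1 F θ).u3Objects θ.γ).levelCarriers k).Dom) (i : ℕ),
        i < (((w1 F θ).u3Objects θ.γ).levelCarriers k).scale X → ∃ (Fz : ℂ → ℂ) (Dset : Set ℂ), DifferentiableOn ℂ Fz Dset ∧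
          (∀ z ∈ Dset, ‖Fz z‖ ≤ (w1 F θ).li.A * (w1 F θ).li.μ ^ ((((w1 F θ).u3Objects θ.γ).levelCarriers k).scale X - 1 - i) *
            Real.exp (-(((w1 F θ).u3Objects θ.γ).κ * (((w1 F θ).u3Objects θ.γ).levelCarriers k).d X))) ∧
          (∀ t ∈ Ioc (0 : ℝ) θ.γ, closedBall (t : ℂ) (w1 F θ).li.r ⊆ Dset) ∧
          (∀ t ∈ Ioc (0 : ℝ) θ.γ, Fz t = (((w1 F θ).u3Objects θ.γ).EA k (Function.update g i t) U X : ℂ))) :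
    S_N22 (RRec₁₃Co (readingOfRecord₁₃Co w1 ℓ₃ ne2 ne1)) :=
  YMDAG.N22.s_N22_rRec₁₃Co_w1_of_oscAnalytic _ w1 (fun _ _ _ _ _ => rfl) hnum hO hA

/-- **THE SLOT-FREE ROAD AT THE READING OF RECORD** («`FadingMemory` by name from a modulus»; module 9″c's `s_N22_rRec₁₃Co_w1_of_ne9_fading` with `hpin := rfl`). -/
theorem s_N22_readingOfRecord₁₃Co_of_ne9_fading
    (h9 : ∀ (F : T4Family) (θ : Stage13Params F N), θ.Provisos₁₃Core F N → θ.Admissible F N → ∀ (k : ℕ),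
      ((w1 F θ).li.analytic θ.γ).Signs ∧ ∃ (Λ : ℕ → ℕ → ℝ) (C₉ : ℝ),
        NE9 (((w1 F θ).u3Objects θ.γ).EA k) (Window θ.γ) (w1 F θ).li.κ Λ ∧
          FadingMemory C₉ ((w1 F θ).li.analytic θ.γ).ω Λ ∧ C₉ ≤ ((w1 F θ).li.analytic θ.γ).C₉) :
    S_N22 (RRec₁₃Co (readingOfRecord₁₃Co w1 ℓ₃ ne2 ne1)) :=
  YMDAG.N22.s_N22_rRec₁₃Co_w1_of_ne9_fading _ w1 (fun _ _ _ _ _ => rfl) h9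

/-- **N18 AT THE READING OF RECORD**: `S_N18` IS «NE5 at every Stage-13 datum key, run length `k` and member `b ∈ ]0, θ.γ]` of W1's level-`k` pairing» (`g₀`, `os` idle;
layer B's `s_N18_rRec₁₃Co_iff`; W1's `ne5_u3Objects_iff` unfolds it to the printed-shape inequality). -/
theorem s_N18_readingOfRecord₁₃Co_iff :
    S_N18 (RRec₁₃Co (readingOfRecord₁₃Co w1 ℓ₃ ne2 ne1)) ↔
      ∀ (F : T4Family) (D : Datum F N) (h : IsDatumOfRecord₁₃CCo F N D) (k : ℕ), N18At (u3OfRecord₁₃ h.params ((w1 F h.params).u3Objects h.params.γ) k) := by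
  rw [s_N18_rRec₁₃Co_iff]
  exact ⟨fun H F D h k => H F D h (fun _ => 0) [] k, fun H F D h _ _ k => H F D h k⟩

/-- **N15 AT THE READING OF RECORD** — the residual component, read at the canonical parameter (layer B's face, component `rfl`). -/
theorem s_N15_readingOfRecord₁₃Co_iff :
    S_N15 (RRec₁₃Co (readingOfRecord₁₃Co w1 ℓ₃ ne2 ne1)) ↔
      ∀ (F : T4Family) (D : Datum F N) (h : IsDatumOfRecord₁₃CCo F N D) (g₀ : ℕ → ℝ) (os : List (ULoop F)) (k : ℕ),
        N15At (ne2OfRecord₁₁ (ne2 F h.params g₀ os k)) :=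
  s_N15_rRec₁₃Co_iff _

/-- **N14 AT THE READING OF RECORD** — the residual dressed tower, read at the canonical parameter. -/
theorem s_N14_readingOfRecord₁₃Co_iff :
    S_N14 (RRec₁₃Co (readingOfRecord₁₃Co w1 ℓ₃ ne2 ne1)) ↔
      ∀ (F : T4Family) (D : Datum F N) (h : IsDatumOfRecord₁₃CCo F N D) (g₀ : ℕ → ℝ) (os : List (ULoop F)), N14At (ne1 F h.params g₀ os) :=
  s_N14_rRec₁₃Co_iff _

/-- **N17 AT THE READING OF RECORD** — NE4 on the datum at the dependent letters of W1's analytic block (`g₀`, `os` idle). -/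
theorem s_N17_readingOfRecord₁₃Co_iff :
    S_N17 (RRec₁₃Co (readingOfRecord₁₃Co w1 ℓ₃ ne2 ne1)) ↔
      ∀ (F : T4Family) (D : Datum F N) (h : IsDatumOfRecord₁₃CCo F N D) (k : ℕ), N17At D (u3OfRecord₁₃ h.params ((w1 F h.params).u3Objects h.params.γ) k) := by
  rw [s_N17_rRec₁₃Co_iff]
  exact ⟨fun H F D h k => H F D h (fun _ => 0) [] k, fun H F D h _ _ k => H F D h k⟩

/-- **(D4) AT THE READING OF RECORD** — the β-read-out binders on the datum at W1's bundles (`g₀`, `os` idle). -/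
theorem s_D4_readingOfRecord₁₃Co_iff :
    S_D4 (RRec₁₃Co (readingOfRecord₁₃Co w1 ℓ₃ ne2 ne1)) ↔
      ∀ (F : T4Family) (D : Datum F N) (h : IsDatumOfRecord₁₃CCo F N D) (k : ℕ), ReadOutAt D (u3OfRecord₁₃ h.params ((w1 F h.params).u3Objects h.params.γ) k) := by
  rw [s_D4_rRec₁₃Co_iff]
  exact ⟨fun H F D h k => H F D h (fun _ => 0) [] k, fun H F D h _ _ k => H F D h k⟩

/-! ## §3 The guarded θ-forms at the regime home `RRec₁₃CoOn (readingOfRecord₁₃Co …) Rg` -/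

/-- **N22 AT THE REGIME-RESTRICTED READING OF RECORD** (guarded θ-form; `Rg := Node00.unityNondeg₁₃ N` is rev 16's binder prefix): `S_N22 (RRec₁₃CoOn (readingOfRecord₁₃Co …) Rg)` IS
«for every family, every Stage-13 tuple with provisos in `Rg`, admissible, and every run length `k`: `N22At (u3OfRecord₁₃ θ ((w1 F θ).u3Objects θ.γ) k)`» (`g₀`, `os` idle). -/
theorem s_N22_readingOfRecord₁₃CoOn_iff (Rg : (F : T4Family) → Stage13Params F N → Prop) :
    S_N22 (RRec₁₃CoOn (readingOfRecord₁₃Co w1 ℓ₃ ne2 ne1) Rg) ↔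
      ∀ (F : T4Family) (θ : Stage13Params F N), θ.Provisos₁₃Core F N → Rg F θ → θ.Admissible F N → ∀ k : ℕ, N22At (u3OfRecord₁₃ θ ((w1 F θ).u3Objects θ.γ) k) := by
  rw [s_N22_rRec₁₃CoOn_iff]
  exact ⟨fun H F θ hP hRg hθ k => H F θ hP hRg hθ (fun _ => 0) [] k, fun H F θ hP hRg hθ _ _ k => H F θ hP hRg hθ k⟩

/-- **N16 AT THE REGIME-RESTRICTED READING OF RECORD** (guarded θ-form): `S_N16` there IS «`N16At` at RR-1's layer of every family carrying an admissible Stage-13 tuple with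
provisos in `Rg`». -/
theorem s_N16_readingOfRecord₁₃CoOn_iff (Rg : (F : T4Family) → Stage13Params F N → Prop) :
    S_N16 (RRec₁₃CoOn (readingOfRecord₁₃Co w1 ℓ₃ ne2 ne1) Rg) ↔
      ∀ (F : T4Family), (∃ θ : Stage13Params F N, θ.Provisos₁₃Core F N ∧ Rg F θ ∧ θ.Admissible F N) →
        N16At (ne3OfRecord₁₁ F (ne3ConstLayerOfRecord₁₁ F N (ℓ₃ F))) := by
  rw [s_N16_rRec₁₃CoOn_iff]
  exact ⟨fun H F ⟨θ, hP, hRg, hθ⟩ => H F θ hP hRg hθ (fun _ => 0) [] 0, fun H F θ hP hRg hθ _ _ _ => H F ⟨θ, hP, hRg, hθ⟩⟩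

/-- **N18 AT THE REGIME-RESTRICTED READING OF RECORD** (guarded θ-form). -/
theorem s_N18_readingOfRecord₁₃CoOn_iff (Rg : (F : T4Family) → Stage13Params F N → Prop) :
    S_N18 (RRec₁₃CoOn (readingOfRecord₁₃Co w1 ℓ₃ ne2 ne1) Rg) ↔
      ∀ (F : T4Family) (θ : Stage13Params F N), θ.Provisos₁₃Core F N → Rg F θ → θ.Admissible F N → ∀ k : ℕ, N18At (u3OfRecord₁₃ θ ((w1 F θ).u3Objects θ.γ) k) := by
  rw [s_N18_rRec₁₃CoOn_iff]
  exact ⟨fun H F θ hP hRg hθ k => H F θ hP hRg hθ (fun _ => 0) [] k, fun H F θ hP hRg hθ _ _ k => H F θ hP hRg hθ k⟩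

/-! ## §4 Honesty at the reading of record -/

/-- **VANISHING W1 TOWERS CLOSE N22's STUB AT THE READING OF RECORD** (module 9″c's rider here): the towers inside `w1` are residual DATA; a discharge of
`S_N22 (RRec₁₃Co (readingOfRecord₁₃Co w1 …))` owes the identification of `(w1 F θ).S k` with the construction's (2.14) terms. -/
theorem s_N22_readingOfRecord₁₃Co_of_EA_zero
    (hs : ∀ (F : T4Family) (θ : Stage13Params F N), θ.Provisos₁₃Core F N → θ.Admissible F N → ((w1 F θ).li.analytic θ.γ).Signs)
    (h0 : ∀ (F : T4Family) (θ : Stage13Params F N), θ.Provisos₁₃Core F N → θ.Admissible F N → ∀ (k : ℕ) (g : ℕ → ℝ)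
      (U : (((w1 F θ).u3Objects θ.γ).levelCarriers k).BgA) (X : (((w1 F θ).u3Objects θ.γ).levelCarriers k).Dom), ((w1 F θ).u3Objects θ.γ).EA k g U X = 0) :
    S_N22 (RRec₁₃Co (readingOfRecord₁₃Co w1 ℓ₃ ne2 ne1)) :=
  YMDAG.N22.s_N22_rRec₁₃Co_w1_of_EA_zero _ w1 (fun _ _ _ _ _ => rfl) hs h0

end Faces

end YMDAG.UVSplit

end
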